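import Literature.Geometry.ComplexAnalytic.QuadricSphereTransversal
import Literature.Geometry.ComplexAnalytic.CyclicNodePencilShellSubmersion
import Literature.Geometry.ComplexAnalytic.HolomorphicMorseLemma
import HarnessLib

/-!
# Near an ordinary double point the pencil function and the Morse radius are jointly submersive on the shells

Family `hodge`, layer `Literature/Geometry/ComplexAnalytic`; theorems only (no definition, no named fact). Written by the
prover seat `hodge-nonav-prover-Bx` (g14, cell `hodge-nonav`) as a generic brick of the ODP-ISOTOPY port (memo
`PROGRAMME-ODP-ISOTOPY-Bx-g13` §2; Picard–Lefschetz binder of crux K1-B, stmt-HodgeConjecture-19716): the `A₁` analogue, in ANY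
number of variables, of `CyclicNodePencilShellSubmersion` (prover-Ax, the cyclic node `x₂^p − (x₀x₁ + x₀^p + x₁^p)`).

Let `Θ` be a `C^∞` open partial homeomorphism of `ℂ^ι` with `C^∞` inverse and `Σᵢ (Θ x)ᵢ² = φ(x)` on its source — a
holomorphic Morse chart of `φ` at a non-degenerate critical point (`HolomorphicMorse.exists_holomorphicMorseChart`). With the
Morse radius `r(x) = Σᵢ |(Θ x)ᵢ|²`:

* `surjective_fderiv_pencil_quadricRadius_of_shell` — **`x ↦ (φ(x), r(x))` has onto real differential at every
  `x ∈ Θ.source` with `r₀² ≤ r(x)` and `|φ(x)| < r₀²`** (`0 < r₀`; no upper radius and no further smallness is needed for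
  the quadric): `(φ, r) = (Σ zᵢ², Σ|zᵢ|²) ∘ Θ` near `x`, the model map is submersive there
  (`surjective_fderiv_quadricLevelRadius_of_shell`) and `DΘ(x)` is invertible (`hasFDerivAt_equiv_of_contDiffOn_symm`);
* `exists_morseChart_quadricShell_submersion` — existence form at a non-degenerate critical point `p` of a holomorphic
  `φ` on an open `U ⊆ ℂᵐ`: a chart `Θ` at `p` (`Θ p = 0`, source inside `U`, holomorphic, `C^∞` with `C^∞` inverse,
  `φ = φ(p) + Σ (Θ ·)ᵢ²`) such that `x ↦ (φ x − φ p, Σ|(Θ x)ᵢ|²)` is submersive on every shell region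
  `{x ∈ Θ.source | r₀² ≤ Σ|(Θ x)ᵢ|², |φ x − φ p| < r₀²}`.

This is the Euclidean input `hsurj₂` of the tangent-lift lemma `Geometry/Manifold/SubmersionLiftVectorField` for a pencil
of hypersurfaces `F_s = f₁ + s·g` near a node of `f₁` (pencil coordinate `−f₁/g` in an affine chart): the lifted fields can
be chosen tangent to the Morse shells. Honest scope: a local computation; nothing here says HC or any rung is proved.

## References

* [Milnor1968] J. Milnor, Singular Points of Complex Hypersurfaces (1968), Cor. 2.9, §4 (Lemma 4.3–4.6, Thm. 4.8) and
  Lemma 5.9–5.10 (the spheres `S_ε` are transverse to the nearby fibres of an isolated critical point).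
* [ArnoldGuseinzadeVarchenko2012] V. I. Arnold, S. M. Gusein-Zade, A. N. Varchenko, Singularities of Differentiable Maps II
  (2012), Part I §1.2 (the ordinary double point), §2.1 (the Milnor fibration in a ball; Morse lemma).
* [Milnor1963] J. Milnor, Morse Theory (1963), Lemma 2.2 (the Morse lemma).
-/

noncomputable section

open Complex Set Filter Topology Metric
open scoped BigOperators ContDiff

namespace Literature.Geometry.ComplexAnalytic

namespace PhamBrieskorn

section Quadric

variable {ι : Type} [Fintype ι]

/-- **Joint submersion of `(φ, r)` on the shells, in the pencil coordinates (quadric case).** Let `Θ` be a `C^∞` open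
partial homeomorphism of `ℂ^ι` with `C^∞` inverse and `Σᵢ (Θ x)ᵢ² = φ(x)` on its source. For `0 < r₀`, at every
`x ∈ Θ.source` with `r₀² ≤ Σᵢ |(Θ x)ᵢ|²` and `|φ(x)| < r₀²`, the real differential of `x ↦ (φ(x), Σᵢ |(Θ x)ᵢ|²)` is onto.
[cite: Milnor1968, Lemma 5.10] [cite: ArnoldGuseinzadeVarchenko2012, Part I §2.1] -/
theorem surjective_fderiv_pencil_quadricRadius_of_shell (Θ : OpenPartialHomeomorph (ι → ℂ) (ι → ℂ))
    (hΘ : ContDiffOn ℝ ∞ Θ Θ.source) (hΘs : ContDiffOn ℝ ∞ Θ.symm Θ.target)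
    (φ : (ι → ℂ) → ℂ) (hΘφ : ∀ x ∈ Θ.source, ∑ i, (Θ x) i ^ 2 = φ x)
    {r₀ : ℝ} (hr₀ : 0 < r₀) {x : ι → ℂ} (hx : x ∈ Θ.source)
    (hlow : r₀ ^ 2 ≤ ∑ i, ‖Θ x i‖ ^ 2) (hφ : ‖φ x‖ < r₀ ^ 2) :
    Function.Surjective (fderiv ℝ (fun x : ι → ℂ => ((φ x : ℂ), (∑ i, ‖Θ x i‖ ^ 2 : ℝ))) x) := by
  haveI : CompleteSpace (ι → ℂ) := inferInstance
  -- the model map and its derivative at `z = Θ x`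
  set G : (ι → ℂ) → ℂ × ℝ := fun z => ((∑ i, z i ^ 2 : ℂ), (∑ i, ‖z i‖ ^ 2 : ℝ)) with hG
  obtain ⟨LG, hLG, -⟩ := hasFDerivAt_quadricLevelRadius (Θ x)
  have hP : ‖∑ i, Θ x i ^ 2‖ < r₀ ^ 2 := by rw [hΘφ x hx]; exact hφ
  have hsurjG : Function.Surjective (fderiv ℝ G (Θ x)) :=
    surjective_fderiv_quadricLevelRadius_of_shell hr₀ hlow hP
  rw [hLG.fderiv] at hsurjG
  -- the chart derivative
  obtain ⟨L, hL⟩ := hasFDerivAt_equiv_of_contDiffOn_symm Θ hΘ hΘs hx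
  -- `(φ, r) = G ∘ Θ` near `x`
  have hcomp : HasFDerivAt (fun x : ι → ℂ => ((φ x : ℂ), (∑ i, ‖Θ x i‖ ^ 2 : ℝ)))
      (LG.comp (L : (ι → ℂ) →L[ℝ] (ι → ℂ))) x := by
    refine (hLG.comp x hL).congr_of_eventuallyEq ?_
    filter_upwards [Θ.open_source.mem_nhds hx] with x' hx'
    simp only [Function.comp_apply, hΘφ x' hx']
  rw [hcomp.fderiv, ContinuousLinearMap.coe_comp]
  exact hsurjG.comp L.surjective

/-- The same with the pencil function normalised at the critical value: if `Σᵢ (Θ x)ᵢ² = φ(x) − φ(p)` on the source, then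
`x ↦ (φ(x) − φ(p), Σᵢ|(Θ x)ᵢ|²)` — equivalently `x ↦ (φ(x), Σᵢ|(Θ x)ᵢ|²)`, which has the same differential — is submersive
at the shell points `r₀² ≤ Σ|(Θ x)ᵢ|²`, `|φ x − φ p| < r₀²`. [cite: Milnor1968, Lemma 5.10] -/
theorem surjective_fderiv_pencil_quadricRadius_of_shell' (Θ : OpenPartialHomeomorph (ι → ℂ) (ι → ℂ))
    (hΘ : ContDiffOn ℝ ∞ Θ Θ.source) (hΘs : ContDiffOn ℝ ∞ Θ.symm Θ.target)
    (φ : (ι → ℂ) → ℂ) (p : ι → ℂ) (hΘφ : ∀ x ∈ Θ.source, φ x = φ p + ∑ i, (Θ x) i ^ 2)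
    {r₀ : ℝ} (hr₀ : 0 < r₀) {x : ι → ℂ} (hx : x ∈ Θ.source)
    (hlow : r₀ ^ 2 ≤ ∑ i, ‖Θ x i‖ ^ 2) (hφ : ‖φ x - φ p‖ < r₀ ^ 2) :
    Function.Surjective (fderiv ℝ (fun x : ι → ℂ => ((φ x : ℂ), (∑ i, ‖Θ x i‖ ^ 2 : ℝ))) x) := by
  have h := surjective_fderiv_pencil_quadricRadius_of_shell Θ hΘ hΘs (fun x => φ x - φ p)
    (fun x hx => by rw [hΘφ x hx]; ring) hr₀ hx hlow hφ
  -- the two maps differ by the constant `(φ p, 0)`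
  have heq : (fun x : ι → ℂ => ((φ x : ℂ), (∑ i, ‖Θ x i‖ ^ 2 : ℝ))) =
      fun x => (fun x : ι → ℂ => ((φ x - φ p : ℂ), (∑ i, ‖Θ x i‖ ^ 2 : ℝ))) x + ((φ p : ℂ), (0 : ℝ)) := by
    funext x
    simp
  rw [heq, fderiv_add_const]
  exact h

end Quadric

/-! ### Existence form at a non-degenerate critical point of a holomorphic function -/

section Existence

variable {m : ℕ}

/-- **The shell submersion for a holomorphic Morse chart (existence form).** Let `φ` be holomorphic on an open `U ⊆ ℂᵐ`
with a non-degenerate critical point `p ∈ U` (`dφ(p) = 0`, Hessian `L` non-degenerate). Then there is an open partial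
homeomorphism `Θ` of `ℂᵐ` with `p ∈ Θ.source ⊆ U`, `Θ p = 0`, holomorphic and real `C^∞` on its source with `C^∞`
inverse, `φ = φ(p) + Σᵢ (Θ ·)ᵢ²` on the source (the holomorphic Morse lemma, `HolomorphicMorse.exists_holomorphicMorseChart`),
and for every `0 < r₀` the map `x ↦ (φ x, Σᵢ |(Θ x)ᵢ|²)` has onto real differential at every `x ∈ Θ.source` with
`r₀² ≤ Σᵢ|(Θ x)ᵢ|²` and `|φ x − φ p| < r₀²`. [cite: Milnor1963, Lemma 2.2] [cite: Milnor1968, Lemma 5.10]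
[cite: ArnoldGuseinzadeVarchenko2012, Part I §2.1] -/
theorem exists_morseChart_quadricShell_submersion {φ : (Fin m → ℂ) → ℂ} {U : Set (Fin m → ℂ)} (hU : IsOpen U)
    (hφ : DifferentiableOn ℂ φ U) {p : Fin m → ℂ} (hp : p ∈ U) (h1 : fderiv ℂ φ p = 0)
    {L : (Fin m → ℂ) →L[ℂ] (Fin m → ℂ) →L[ℂ] ℂ} (h2 : HasFDerivAt (fderiv ℂ φ) L p)
    (hL : ∀ u, (∀ v, L u v = 0) → u = 0) :
    ∃ Θ : OpenPartialHomeomorph (Fin m → ℂ) (Fin m → ℂ),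
      p ∈ Θ.source ∧ Θ p = 0 ∧ Θ.source ⊆ U ∧
      DifferentiableOn ℂ Θ Θ.source ∧ ContDiffOn ℝ ∞ Θ Θ.source ∧ ContDiffOn ℝ ∞ Θ.symm Θ.target ∧
      (∀ x ∈ Θ.source, φ x = φ p + ∑ i, (Θ x i) ^ 2) ∧
      ∀ {r₀ : ℝ}, 0 < r₀ → ∀ {x : Fin m → ℂ}, x ∈ Θ.source → r₀ ^ 2 ≤ ∑ i, ‖Θ x i‖ ^ 2 →
        ‖φ x - φ p‖ < r₀ ^ 2 →
        Function.Surjective (fderiv ℝ (fun x : Fin m → ℂ => ((φ x : ℂ), (∑ i, ‖Θ x i‖ ^ 2 : ℝ))) x) := by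
  obtain ⟨Θ, hpΘ, hΘp, hΘU, hhol, hΘ, hΘs, hΘφ⟩ := HolomorphicMorse.exists_holomorphicMorseChart hU hφ hp h1 h2 hL
  exact ⟨Θ, hpΘ, hΘp, hΘU, hhol, hΘ, hΘs, hΘφ, fun hr₀ _ hx hlow hφx =>
    surjective_fderiv_pencil_quadricRadius_of_shell' Θ hΘ hΘs φ p hΘφ hr₀ hx hlow hφx⟩

end Existence

end PhamBrieskorn

end Literature.Geometry.ComplexAnalytic

end
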